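import Summits.Ventures.Crystal3D.Theorems.StickyWulffConstantGenericWallFloorRayMirror
import HarnessLib

/-!
# The ℚ-mirror of the forced ray over a BOX of steerings: `rayBranchesBox` and its transfer (crux `GenericWallFloor`,
# stmt-Ventures-19480 / `GenericWallFloorV5` stmt-Ventures-23910, line `WallLedgerG`; the kernel form of the K3 engine's per-box word sets,
# HOME/wall-p1-g14/K3-g14.md §1–2, cf-p1 (cviii) «describedCut, valuable»)

HONEST FRAMING. Venture `Summits/Ventures/Crystal3D` (cell `crystal3d-full`), helper `--supports` the law-v5 crux `GenericWallFloorV5`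
(stmt-Ventures-23910) of `route-Ventures-StickyWulffConstant`, registered line `WallLedgerG`.  Rung credit only; census-free, standard axioms;
F-C1 not moved; NOT a certificate and not the word-uniform K3 theorem — only its enabling lemma.

`…RayMirror` (19480-p2) transfers the real forced ray to the finite computable set `rayBranches L Z K` when the local steering has a
RATIONAL direction `Z`.  A coverage certificate is organised by BOXES of steerings: the wall normal `ν` ranges over a gnomonic box, i.e.
(in cubic numerators) over the cone spanned by finitely many rational corners `Zs c`.  This file gives the box version:
* `capperSetBox L Zs` — the slot numerators `Q` with `Q·L < 0` that are NOT STRICTLY DOMINATED on the box: no other candidate `Q'` has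
  `Q·P < Q'·P` at every corner `P ∈ Zs`;  `rayBranchesBox L Zs K` — all letter sequences of length `K` the local recursion can produce when at
  each level every non-dominated candidate is kept and the corner steerings are reflected along (`Zs ↦ Zs.map (reflNum L')`).  Decidable data over `ℚ`.
* `capperSet_subset_capperSetBox` — pointwise ⊆ box for a rational steering in the cone;
* **`exists_rayBranchBox`** (TRANSFER) — if `κ(A⁻¹z) = ∑ c, λ c • Zs c` with real `λ c ≥ 0`, some `λ c > 0` (the steering's direction lies in the
  cone of the corners), then the numerators of the letters `ℓ_1, …, ℓ_K` of the real forced ray `forcedTop z ⟨A,u,0⟩ n ·` form an element of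
  `rayBranchesBox L₀ (corners reflected by L₀) K`.  So a per-box list of words computed by this recursion (the K3 engine's rule, HOME/wall-p1-g14/k3/)
  contains every ray word of every steering in the box — the «dominance lemma» of memo K3-g14 §2, kernel-checked.
WHAT THIS IS NOT: no table is evaluated here; not the stub; F-C1 not moved.
-/

noncomputable section

namespace Summit.Ventures.Crystal3D.Theorems

open Summit.Ventures.Crystal3D Finset Matrix
open scoped InnerProductSpace BigOperators

/-! ### The box recursion (decidable data over `ℚ`) -/

/-- `Q` is STRICTLY DOMINATED on the box with corner steerings `Zs` (at local letter `L`): some candidate `Q'` (`Q'·L < 0`) beats it at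
every corner (Boolean test). -/
def dominatedOn (L : Fin 3 → ℚ) (Zs : List (Fin 3 → ℚ)) (Q : Fin 3 → ℚ) : Bool :=
  slotNums.any fun Q' => decide (Q' ⬝ᵥ L < 0) && Zs.all fun P => decide (Q ⬝ᵥ P < Q' ⬝ᵥ P)

/-- The Boolean test unfolded. -/
theorem dominatedOn_iff (L : Fin 3 → ℚ) (Zs : List (Fin 3 → ℚ)) (Q : Fin 3 → ℚ) :
    dominatedOn L Zs Q = true ↔ ∃ Q' ∈ slotNums, Q' ⬝ᵥ L < 0 ∧ ∀ P ∈ Zs, Q ⬝ᵥ P < Q' ⬝ᵥ P := by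
  simp [dominatedOn, List.any_eq_true, List.all_eq_true]

/-- The admissible cappers ON A BOX: slot numerators `Q` with `Q·L < 0` that are not strictly dominated on the box. -/
def capperSetBox (L : Fin 3 → ℚ) (Zs : List (Fin 3 → ℚ)) : List (Fin 3 → ℚ) :=
  slotNums.filter fun Q => Q ⬝ᵥ L < 0 ∧ dominatedOn L Zs Q = false

/-- **All letter sequences of length `K`** the local recursion can produce over the box (every non-dominated candidate kept; the corner
steerings are reflected along): `D ∈ capperSetBox L Zs`, `L' = L + 2D`, `Zs' = Zs.map (reflNum L')`. -/
def rayBranchesBox : (Fin 3 → ℚ) → List (Fin 3 → ℚ) → ℕ → List (List (Fin 3 → ℚ))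
  | _, _, 0 => [[]]
  | L, Zs, K + 1 => (capperSetBox L Zs).flatMap fun D =>
      (rayBranchesBox (L + (2 : ℚ) • D) (Zs.map (reflNum (L + (2 : ℚ) • D))) K).map fun rest => (L + (2 : ℚ) • D) :: rest

/-- Membership in `rayBranchesBox … (K + 1)`, unfolded. -/
theorem mem_rayBranchesBox_succ {L : Fin 3 → ℚ} {Zs : List (Fin 3 → ℚ)} {K : ℕ} {Ls : List (Fin 3 → ℚ)} :
    Ls ∈ rayBranchesBox L Zs (K + 1) ↔ ∃ D ∈ capperSetBox L Zs,
      ∃ rest ∈ rayBranchesBox (L + (2 : ℚ) • D) (Zs.map (reflNum (L + (2 : ℚ) • D))) K, Ls = (L + (2 : ℚ) • D) :: rest := by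
  simp only [rayBranchesBox, List.mem_flatMap, List.mem_map]
  constructor
  · rintro ⟨D, hD, rest, hrest, rfl⟩; exact ⟨D, hD, rest, hrest, rfl⟩
  · rintro ⟨D, hD, rest, hrest, rfl⟩; exact ⟨D, hD, rest, hrest, rfl⟩

/-! ### Pointwise ⊆ box (rational steering in the cone) -/

/-- A candidate maximising `Q ↦ Q·Z` for a steering `Z = ∑ λ_c • P_c` in the cone of the corners (`λ ≥ 0`, some `λ > 0`) is not strictly
dominated on the box. -/
theorem not_dominatedOn_of_max {N : ℕ} {L : Fin 3 → ℚ} {Zs : Fin N → (Fin 3 → ℚ)} {l : Fin N → ℚ}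
    (hl : ∀ c, 0 ≤ l c) (hlpos : ∃ c, 0 < l c) {Q : Fin 3 → ℚ}
    (hmax : ∀ Q' ∈ slotNums, Q' ⬝ᵥ L < 0 → Q' ⬝ᵥ (∑ c, l c • Zs c) ≤ Q ⬝ᵥ (∑ c, l c • Zs c)) :
    dominatedOn L (List.ofFn Zs) Q = false := by
  rw [Bool.eq_false_iff, Ne, dominatedOn_iff]
  rintro ⟨Q', hQ', hQ'L, hdom⟩
  have h := hmax Q' hQ' hQ'L
  have hlt : Q ⬝ᵥ (∑ c, l c • Zs c) < Q' ⬝ᵥ (∑ c, l c • Zs c) := by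
    rw [dotProduct_sum, dotProduct_sum]
    obtain ⟨c₀, hc₀⟩ := hlpos
    apply Finset.sum_lt_sum
    · intro c _
      rw [dotProduct_smul, dotProduct_smul, smul_eq_mul, smul_eq_mul]
      exact mul_le_mul_of_nonneg_left (hdom (Zs c) (List.mem_ofFn.2 ⟨c, rfl⟩)).le (hl c)
    · refine ⟨c₀, Finset.mem_univ _, ?_⟩
      rw [dotProduct_smul, dotProduct_smul, smul_eq_mul, smul_eq_mul]
      exact mul_lt_mul_of_pos_left (hdom (Zs c₀) (List.mem_ofFn.2 ⟨c₀, rfl⟩)) hc₀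
  exact absurd h (not_le.2 hlt)

/-- **Pointwise ⊆ box**: for a rational steering in the cone of the corners, `capperSet L Z ⊆ capperSetBox L corners`. -/
theorem capperSet_subset_capperSetBox {N : ℕ} {L : Fin 3 → ℚ} {Zs : Fin N → (Fin 3 → ℚ)} {l : Fin N → ℚ}
    (hl : ∀ c, 0 ≤ l c) (hlpos : ∃ c, 0 < l c) {Q : Fin 3 → ℚ} (hQ : Q ∈ capperSet L (∑ c, l c • Zs c)) :
    Q ∈ capperSetBox L (List.ofFn Zs) := by
  rw [capperSet, List.mem_filter, decide_eq_true_eq] at hQ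
  rw [capperSetBox, List.mem_filter, decide_eq_true_eq]
  exact ⟨hQ.1, hQ.2.1, not_dominatedOn_of_max hl hlpos hQ.2.2⟩

/-! ### Cubic numerators over a cone -/

/-- **Cubic numerators of a model reflection, cone form**: if `κ(y) = ∑ λ_c • castVec (Z c)` and `√3·κ(μ) = M` (`μ` unit) then
`κ(R_μ y) = ∑ λ_c • castVec (reflNum M (Z c))`. -/
theorem cubicCoords_reflection_cone {ι : Type*} [Fintype ι] {μ y : EuclideanSpace ℝ (Fin 3)} (hμ : ‖μ‖ = 1)
    {l : ι → ℝ} {Z : ι → (Fin 3 → ℚ)} {M : Fin 3 → ℚ}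
    (hy : cubicCoords y = ∑ c, l c • castVec (Z c)) (hM : castVec M = Real.sqrt 3 • cubicCoords μ) :
    cubicCoords ((ℝ ∙ μ)ᗮ.reflection y) = ∑ c, l c • castVec (reflNum M (Z c)) := by
  obtain ⟨-, hs3, -, hs3p, -⟩ := sqrt_two_three_facts
  have hμ' : cubicCoords μ = (Real.sqrt 3)⁻¹ • castVec M := by
    rw [hM, smul_smul, inv_mul_cancel₀ hs3p.ne', one_smul]
  have h3 : (Real.sqrt 3)⁻¹ * (Real.sqrt 3)⁻¹ = 1 / 3 := by rw [← mul_inv, hs3]; norm_num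
  rw [reflection_unit_apply hμ, cubicCoords_sub, cubicCoords_smul, inner_eq_cubicCoords, hy, hμ', sum_dotProduct,
    smul_smul]
  have hterm : ∀ c, l c • castVec (reflNum M (Z c)) =
      l c • castVec (Z c) - (l c * ((2 / 3 : ℝ) * (castVec (Z c) ⬝ᵥ castVec M))) • castVec M := by
    intro c
    rw [castVec_reflNum, smul_sub, smul_smul]
  simp_rw [hterm]
  rw [Finset.sum_sub_distrib, ← Finset.sum_smul]
  congr 1
  congr 1
  simp_rw [smul_dotProduct, dotProduct_smul, smul_eq_mul]
  rw [Finset.mul_sum, Finset.sum_mul]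
  apply Finset.sum_congr rfl
  intro c _
  linear_combination (2 * l c * (castVec (Z c) ⬝ᵥ castVec M)) * h3

/-! ### The transfer over a box -/

section Transfer

variable {A : EuclideanSpace ℝ (Fin 3) ≃ₗᵢ[ℝ] EuclideanSpace ℝ (Fin 3)} {u n z : EuclideanSpace ℝ (Fin 3)}
  {N : ℕ} {l : Fin N → ℝ}

/-- **Box transfer, all levels from level `j`.**  If level `j` of the forced ray has local entry-normal numerator `−L` and local steering
`κ(F_j⁻¹z) = ∑ λ_c • Zs c` in the cone of the rational corners `Zs` (`λ ≥ 0`, some `λ > 0`), then the numerators of the next `K` letters form an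
element of `rayBranchesBox L (List.ofFn Zs) K`. -/
theorem exists_rayBranchBox_from (hn : ‖n‖ = 1)
    (hmenu : ∀ w ∈ fccSlots, ⟪A w, n⟫_ℝ = 0 ∨ ⟪A w, n⟫_ℝ = Real.sqrt (2 / 3) ∨ ⟪A w, n⟫_ℝ = -Real.sqrt (2 / 3))
    (hl : ∀ c, 0 ≤ l c) (hlpos : ∃ c, 0 < l c) :
    ∀ (K j : ℕ) (L : Fin 3 → ℚ) (Zs : Fin N → (Fin 3 → ℚ)),
      castVec L = -(Real.sqrt 3 • cubicCoords ((forcedTop z ⟨A, u, 0⟩ n j).frame.symm (forcedTop z ⟨A, u, 0⟩ n j).nrm)) →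
      cubicCoords ((forcedTop z ⟨A, u, 0⟩ n j).frame.symm z) = ∑ c, l c • castVec (Zs c) →
      ∃ Ls ∈ rayBranchesBox L (List.ofFn Zs) K, Ls.map castVec = (List.range K).map fun i =>
        Real.sqrt 3 • cubicCoords ((forcedTop z ⟨A, u, 0⟩ n (j + i)).frame.symm (nextNormal (forcedTop z ⟨A, u, 0⟩ n (j + i))))
  | 0, j, L, Zs, _, _ => ⟨[], by simp [rayBranchesBox], by simp⟩
  | K + 1, j, L, Zs, hL, hZ => by
    obtain ⟨hs2, hs3, hs2p, hs3p, h23⟩ := sqrt_two_three_facts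
    set e := forcedTop z ⟨A, u, 0⟩ n j with he
    obtain ⟨hν, hmenuj, -⟩ := forcedTop_chain_invariant z A u hn hmenu j
    rw [← he] at hν hmenuj
    obtain ⟨hd, hdpos, hmax, hnext, hnrm', hz'⟩ := forcedTop_local_step z e hν hmenuj (forcedTop_dir z ⟨A, u, 0⟩ n j)
    have hN1 : ‖nextNormal e‖ = 1 := (nextNormal_unit_menu (forcedTop_dir z ⟨A, u, 0⟩ n j) hν hmenuj).1
    have hlam : cubicCoords (e.frame.symm e.nrm) = -((Real.sqrt 3)⁻¹ • castVec L) := by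
      rw [hL, smul_neg, smul_smul, inv_mul_cancel₀ hs3p.ne', one_smul, neg_neg]
    obtain ⟨D, hDmem, hD⟩ := exists_slotNum_of_mem_fccSlots hd
    have h6 : 0 < (Real.sqrt 2)⁻¹ * (Real.sqrt 3)⁻¹ := by positivity
    -- inner products against the local normal: `⟪q, λ⟫ = −(Q·L)/(√2√3)`
    have hinn : ∀ {q : EuclideanSpace ℝ (Fin 3)} {Q : Fin 3 → ℚ}, cubicCoords q = (Real.sqrt 2)⁻¹ • castVec Q →
        ⟪q, e.frame.symm e.nrm⟫_ℝ = -((Real.sqrt 2)⁻¹ * (Real.sqrt 3)⁻¹) * (((Q ⬝ᵥ L : ℚ) : ℝ)) := by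
      intro q Q hq
      rw [inner_eq_cubicCoords, hq, hlam, smul_dotProduct, dotProduct_neg, dotProduct_smul, castVec_dotProduct, smul_eq_mul,
        smul_eq_mul]
      ring
    -- inner products against the steering over the cone: `⟪q, F⁻¹z⟫ = (√2)⁻¹ ∑ λ_c (Q·Zs c)`
    have hinz : ∀ {q : EuclideanSpace ℝ (Fin 3)} {Q : Fin 3 → ℚ}, cubicCoords q = (Real.sqrt 2)⁻¹ • castVec Q →
        ⟪q, e.frame.symm z⟫_ℝ = (Real.sqrt 2)⁻¹ * ∑ c, l c * (((Q ⬝ᵥ Zs c : ℚ) : ℝ)) := by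
      intro q Q hq
      rw [inner_eq_cubicCoords, hq, hZ, smul_dotProduct, dotProduct_sum, smul_eq_mul]
      congr 1
      apply Finset.sum_congr rfl
      intro c _
      rw [dotProduct_smul, castVec_dotProduct, smul_eq_mul]
    -- `D ∈ capperSetBox L (List.ofFn Zs)`
    have hDcap : D ∈ capperSetBox L (List.ofFn Zs) := by
      rw [capperSetBox, List.mem_filter, decide_eq_true_eq]
      refine ⟨hDmem, ?_, ?_⟩
      · have h1 := hinn hD
        rw [hdpos] at h1
        have hr : 0 < Real.sqrt (2 / 3) := Real.sqrt_pos.2 (by norm_num)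
        have h2 : ((Real.sqrt 2)⁻¹ * (Real.sqrt 3)⁻¹) * (((D ⬝ᵥ L : ℚ) : ℝ)) < 0 := by linarith
        have h3 : (((D ⬝ᵥ L : ℚ) : ℝ)) < 0 := by
          by_contra hge; push Not at hge
          exact absurd h2 (not_lt.2 (mul_nonneg h6.le hge))
        exact_mod_cast h3
      · rw [Bool.eq_false_iff, Ne, dominatedOn_iff]
        rintro ⟨Q', hQ', hQ'L, hdom⟩
        obtain ⟨q, hq, hqc⟩ := exists_slot_of_mem_slotNums hQ'
        have hqpos : 0 < ⟪q, e.frame.symm e.nrm⟫_ℝ := by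
          rw [hinn hqc]
          have : (((Q' ⬝ᵥ L : ℚ) : ℝ)) < 0 := by exact_mod_cast hQ'L
          nlinarith
        have h := hmax q hq hqpos
        rw [hinz hqc, hinz hD] at h
        have hc : 0 < (Real.sqrt 2)⁻¹ := by positivity
        have hle : ∑ c, l c * (((Q' ⬝ᵥ Zs c : ℚ) : ℝ)) ≤ ∑ c, l c * (((D ⬝ᵥ Zs c : ℚ) : ℝ)) := le_of_mul_le_mul_left h hc
        have hlt : ∑ c, l c * (((D ⬝ᵥ Zs c : ℚ) : ℝ)) < ∑ c, l c * (((Q' ⬝ᵥ Zs c : ℚ) : ℝ)) := by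
          obtain ⟨c₀, hc₀⟩ := hlpos
          apply Finset.sum_lt_sum
          · intro c _
            have : (((D ⬝ᵥ Zs c : ℚ) : ℝ)) < (((Q' ⬝ᵥ Zs c : ℚ) : ℝ)) := by
              exact_mod_cast hdom (Zs c) (List.mem_ofFn.2 ⟨c, rfl⟩)
            exact mul_le_mul_of_nonneg_left this.le (hl c)
          · refine ⟨c₀, Finset.mem_univ _, ?_⟩
            have : (((D ⬝ᵥ Zs c₀ : ℚ) : ℝ)) < (((Q' ⬝ᵥ Zs c₀ : ℚ) : ℝ)) := by
              exact_mod_cast hdom (Zs c₀) (List.mem_ofFn.2 ⟨c₀, rfl⟩)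
            exact mul_lt_mul_of_pos_left this hc₀
        exact absurd hle (not_le.2 hlt)
    -- the next letter `ℓ' = 2√(2/3) d − λ` has numerator `L + 2D`
    have hℓ' : castVec (L + (2 : ℚ) • D) = Real.sqrt 3 • cubicCoords (e.frame.symm (nextNormal e)) := by
      rw [hnext, cubicCoords_sub, cubicCoords_smul, hD, hlam, castVec_add, castVec_smul]
      have h23' : Real.sqrt 3 * (2 * Real.sqrt (2 / 3)) * (Real.sqrt 2)⁻¹ = 2 := by
        rw [h23]; field_simp
      rw [smul_sub, smul_smul, smul_smul, h23', smul_neg, smul_smul, mul_inv_cancel₀ hs3p.ne', one_smul, sub_neg_eq_add]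
      push_cast
      rw [add_comm]
    -- level `j + 1` data
    have hfr : (forcedTop z ⟨A, u, 0⟩ n (j + 1)).frame = (pushEntry z e (nextNormal e)).frame := rfl
    have hnr : (forcedTop z ⟨A, u, 0⟩ n (j + 1)).nrm = nextNormal e := rfl
    have hL' : castVec (L + (2 : ℚ) • D) =
        -(Real.sqrt 3 • cubicCoords ((forcedTop z ⟨A, u, 0⟩ n (j + 1)).frame.symm (forcedTop z ⟨A, u, 0⟩ n (j + 1)).nrm)) := by
      rw [hfr, hnr, hnrm', cubicCoords_neg, smul_neg, neg_neg, hℓ']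
    have hZ' : cubicCoords ((forcedTop z ⟨A, u, 0⟩ n (j + 1)).frame.symm z) =
        ∑ c, l c • castVec ((reflNum (L + (2 : ℚ) • D) ∘ Zs) c) := by
      rw [hfr, hz']
      have hm1 : ‖e.frame.symm (nextNormal e)‖ = 1 := by rw [LinearIsometryEquiv.norm_map, hN1]
      exact cubicCoords_reflection_cone hm1 hZ hℓ'
    obtain ⟨rest, hrest, hmap⟩ := exists_rayBranchBox_from hn hmenu hl hlpos K (j + 1) _ _ hL' hZ'
    refine ⟨(L + (2 : ℚ) • D) :: rest, mem_rayBranchesBox_succ.2 ⟨D, hDcap, rest, ?_, rfl⟩, ?_⟩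
    · rw [List.map_ofFn]; exact hrest
    · rw [List.map_cons, List.range_succ_eq_map, List.map_cons, List.map_map, hmap, Nat.add_zero, hℓ']
      congr 1
      apply List.map_congr_left
      intro i _
      simp only [Function.comp_apply]
      rw [show j + (i + 1) = j + 1 + i by omega]

/-- **BOX TRANSFER from the bottom.**  Base frame `A`, slot `u`, admissible unit menu normal `n` with letter numerator `L₀`
(`castVec L₀ = √3·κ(A⁻¹n)`), steering `z` whose cubic coordinates in the base frame lie in the cone of the rational corners `Zs`:
`κ(A⁻¹z) = ∑ c, λ c • Zs c` with `λ ≥ 0`, some `λ c > 0`.  Then for every `K` the numerators of the letters `ℓ_1, …, ℓ_K` of the forced ray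
`forcedTop z ⟨A, u, 0⟩ n ·` form an element of `rayBranchesBox L₀ (List.ofFn (reflNum L₀ ∘ Zs)) K` — the per-box word set of the K3 engine. -/
theorem exists_rayBranchBox (hn : ‖n‖ = 1)
    (hmenu : ∀ w ∈ fccSlots, ⟪A w, n⟫_ℝ = 0 ∨ ⟪A w, n⟫_ℝ = Real.sqrt (2 / 3) ∨ ⟪A w, n⟫_ℝ = -Real.sqrt (2 / 3))
    {Zs : Fin N → (Fin 3 → ℚ)} {L₀ : Fin 3 → ℚ} (hZ : cubicCoords (A.symm z) = ∑ c, l c • castVec (Zs c))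
    (hl : ∀ c, 0 ≤ l c) (hlpos : ∃ c, 0 < l c)
    (hL₀ : castVec L₀ = Real.sqrt 3 • cubicCoords (A.symm n)) (K : ℕ) :
    ∃ Ls ∈ rayBranchesBox L₀ (List.ofFn (reflNum L₀ ∘ Zs)) K, Ls.map castVec = (List.range K).map fun i =>
      Real.sqrt 3 • cubicCoords ((forcedTop z ⟨A, u, 0⟩ n i).frame.symm (nextNormal (forcedTop z ⟨A, u, 0⟩ n i))) := by
  have hfr : (forcedTop z ⟨A, u, 0⟩ n 0).frame = twinFrame A n := rfl
  have hnr : (forcedTop z ⟨A, u, 0⟩ n 0).nrm = n := rfl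
  have hL : castVec L₀ =
      -(Real.sqrt 3 • cubicCoords ((forcedTop z ⟨A, u, 0⟩ n 0).frame.symm (forcedTop z ⟨A, u, 0⟩ n 0).nrm)) := by
    rw [hfr, hnr, symm_twinFrame_self A hn, cubicCoords_neg, smul_neg, neg_neg, hL₀]
  have hZ0 : cubicCoords ((forcedTop z ⟨A, u, 0⟩ n 0).frame.symm z) = ∑ c, l c • castVec ((reflNum L₀ ∘ Zs) c) := by
    rw [hfr, symm_twinFrame_apply A hn]
    exact cubicCoords_reflection_cone (by rw [LinearIsometryEquiv.norm_map, hn]) hZ hL₀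
  have h := exists_rayBranchBox_from (u := u) hn hmenu hl hlpos K 0 L₀ (reflNum L₀ ∘ Zs) hL hZ0
  simpa only [Nat.zero_add] using h

end Transfer

end Summit.Ventures.Crystal3D.Theorems

end
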